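import Summits.QuantumFields.YangMills.Theorems.AllWindowsColdBoxLineGaussToolkit
import Summits.QuantumFields.YangMills.Theorems.AllWindowsColdBoxGaussSideCovarianceTransfer
import Summits.QuantumFields.YangMills.Theorems.AllWindowsColdBoxTiltMomentsThresholds
import Summits.QuantumFields.YangMills.Theorems.WeakCouplingRatesColdBoxDirichletRestrictedCov
import Literature.Analysis.FunctionSpaces.SquaredBesselExistence
import Mathlib.Analysis.Convex.Integral
import Mathlib.Analysis.Convex.Mul
import Summits.QuantumFields.YangMills.Theorems.AllWindowsColdBoxTiltMomentsOfCubic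
import HarnessLib

/-!
# LINE-17 «hypercontractive second-order tilt expansion» on crux `AllWindowsColdBox.BoxMidWindowsSU22` (stmt-QuantumFields-24003):
# F(iii) of stub F `stub_gaussSideTerms` — tools for the first-order tilt term (STUB-PLAN-E §5 F(iii))

Generic measure-theoretic glue for F(iii) (`|∫ f̃ g̃_T W dν| ≤ K⌈β^θ⌉⁶/β`): three-factor weighted AM–GM inequalities, pointwise
and integrated (`abs_mul_mul_le_quartic_sq`: `|abc| ≤ l(a⁴+b⁴)/4 + l⁻¹c²/2`; `abs_mul_mul_le_sq_quartic`: `|abc| ≤ la²/2 + l⁻¹(b⁴+c⁴)/4`;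
`integrable_mul_mul_of_quartic_sq`), centred-moment bounds on a probability space (`integral_centred_pow_four_le`:
`∫(X − EX)⁴ ≤ 16∫X⁴`; `integral_centred_sq_le`; `integral_sub_const_pow_eight_le`; `sq_integral_le_integral_sq`), the real
bookkeeping `tilt_bookkeeping` of the six error terms of the engine (sibling file `…GaussSideTiltTransfer`), `abs_add_six_le`, and the
threshold `eventually_ceil_pow_le` (`⌈β^θ⌉⁶ ≤ β²`, `⌈β^θ⌉⁸ ≤ β⁴` eventually, `θ ≤ 1/16`).

No definition; standard axioms.  HONEST LABEL: helper lemmas toward one third of the OPEN registered stub F of one critic-PASSed line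
on the R2ξ″ RECORD-rung crux 24003; no stub by name, no crux, rung or summit; the Yang–Mills mass gap is NOT proved by this file.
-/

set_option autoImplicit false

noncomputable section

open MeasureTheory ProbabilityTheory Finset
open Literature.MathematicalPhysics.QuantumLattice
open Literature.MathematicalPhysics.QuantumFieldTheory
open Literature.MathematicalPhysics.QuantumFieldTheory.LatticeMaxwell
open Summit.QuantumFields.YangMills.Theorems.WeakCouplingRates
open Summit.QuantumFields.YangMills.Theorems.ColdBoxAllGroups
open Summit.QuantumFields.YangMills.Theorems.FreeEnergyLogCoefficient

namespace Summit.QuantumFields.YangMills.Theorems.AllWindowsColdBoxBoxMidLine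

section ThreeFactor

variable {Ω : Type*} [MeasurableSpace Ω] {μ : Measure Ω}

/-- Three-factor weighted AM–GM, one small factor in `L²`: `|a b c| ≤ l(a⁴ + b⁴)/4 + l⁻¹c²/2` (`l > 0`). -/
theorem abs_mul_mul_le_quartic_sq (a b c : ℝ) {l : ℝ} (hl : 0 < l) : |a * b * c| ≤ l * (a ^ 4 + b ^ 4) / 4 + l⁻¹ * c ^ 2 / 2 := by
  have h1 : |a * b * c| ≤ (l * (a * b) ^ 2 + l⁻¹ * c ^ 2) / 2 := by
    rw [abs_mul]
    have h : 2 * l * (|a * b| * |c|) ≤ l ^ 2 * (a * b) ^ 2 + c ^ 2 := by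
      nlinarith [sq_nonneg (l * |a * b| - |c|), sq_abs (a * b), sq_abs c]
    have hl' : l⁻¹ * c ^ 2 = c ^ 2 / l := by rw [inv_mul_eq_div]
    rw [hl', le_div_iff₀ (by norm_num : (0:ℝ) < 2)]
    have : l * (a * b) ^ 2 + c ^ 2 / l = (l ^ 2 * (a * b) ^ 2 + c ^ 2) / l := by field_simp
    rw [this, le_div_iff₀ hl]
    linarith
  have h2 : (a * b) ^ 2 ≤ (a ^ 4 + b ^ 4) / 2 := by nlinarith [sq_nonneg (a ^ 2 - b ^ 2)]
  have h3 := mul_le_mul_of_nonneg_left h2 hl.le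
  linarith

/-- Three-factor weighted AM–GM, two small factors in `L⁴`: `|a b c| ≤ l a²/2 + l⁻¹(b⁴ + c⁴)/4` (`l > 0`). -/
theorem abs_mul_mul_le_sq_quartic (a b c : ℝ) {l : ℝ} (hl : 0 < l) : |a * b * c| ≤ l * a ^ 2 / 2 + l⁻¹ * (b ^ 4 + c ^ 4) / 4 := by
  have h1 : |a * b * c| ≤ (l * a ^ 2 + l⁻¹ * (b * c) ^ 2) / 2 := by
    rw [mul_assoc, abs_mul]
    have h : 2 * l * (|a| * |b * c|) ≤ l ^ 2 * a ^ 2 + (b * c) ^ 2 := by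
      nlinarith [sq_nonneg (l * |a| - |b * c|), sq_abs a, sq_abs (b * c)]
    have hl' : l⁻¹ * (b * c) ^ 2 = (b * c) ^ 2 / l := by rw [inv_mul_eq_div]
    rw [hl', le_div_iff₀ (by norm_num : (0:ℝ) < 2)]
    have : l * a ^ 2 + (b * c) ^ 2 / l = (l ^ 2 * a ^ 2 + (b * c) ^ 2) / l := by field_simp
    rw [this, le_div_iff₀ hl]
    linarith
  have h2 : (b * c) ^ 2 ≤ (b ^ 4 + c ^ 4) / 2 := by nlinarith [sq_nonneg (b ^ 2 - c ^ 2)]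
  have h3 := mul_le_mul_of_nonneg_left h2 (inv_nonneg.2 hl.le)
  linarith

/-- Integrated `abs_mul_mul_le_quartic_sq`: `|∫ A B C| ≤ l(∫A⁴ + ∫B⁴)/4 + l⁻¹∫C²/2`. -/
theorem abs_integral_mul_mul_le_quartic_sq {A B C : Ω → ℝ} (hA4 : Integrable (fun ω => A ω ^ 4) μ) (hB4 : Integrable (fun ω => B ω ^ 4) μ)
    (hC2 : Integrable (fun ω => C ω ^ 2) μ) {l : ℝ} (hl : 0 < l) :
    |∫ ω, A ω * B ω * C ω ∂μ| ≤ l * ((∫ ω, A ω ^ 4 ∂μ) + ∫ ω, B ω ^ 4 ∂μ) / 4 + l⁻¹ * (∫ ω, C ω ^ 2 ∂μ) / 2 := by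
  have hAB : Integrable (fun ω => A ω ^ 4 + B ω ^ 4) μ := hA4.add hB4
  have hR1 : Integrable (fun ω => l * (A ω ^ 4 + B ω ^ 4) / 4) μ := (hAB.const_mul l).div_const 4
  have hR2 : Integrable (fun ω => l⁻¹ * C ω ^ 2 / 2) μ := (hC2.const_mul l⁻¹).div_const 2
  have hR : Integrable (fun ω => l * (A ω ^ 4 + B ω ^ 4) / 4 + l⁻¹ * C ω ^ 2 / 2) μ := hR1.add hR2
  refine (abs_integral_le_integral_abs).trans ((integral_mono_of_nonneg (ae_of_all _ fun ω => abs_nonneg _) hR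
    (ae_of_all _ fun ω => abs_mul_mul_le_quartic_sq (A ω) (B ω) (C ω) hl)).trans (le_of_eq ?_))
  rw [integral_add hR1 hR2, integral_div, integral_const_mul, integral_add hA4 hB4, integral_div, integral_const_mul]

/-- Integrated `abs_mul_mul_le_sq_quartic`: `|∫ A B C| ≤ l∫A²/2 + l⁻¹(∫B⁴ + ∫C⁴)/4`. -/
theorem abs_integral_mul_mul_le_sq_quartic {A B C : Ω → ℝ} (hA2 : Integrable (fun ω => A ω ^ 2) μ) (hB4 : Integrable (fun ω => B ω ^ 4) μ)
    (hC4 : Integrable (fun ω => C ω ^ 4) μ) {l : ℝ} (hl : 0 < l) :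
    |∫ ω, A ω * B ω * C ω ∂μ| ≤ l * (∫ ω, A ω ^ 2 ∂μ) / 2 + l⁻¹ * ((∫ ω, B ω ^ 4 ∂μ) + ∫ ω, C ω ^ 4 ∂μ) / 4 := by
  have hBC : Integrable (fun ω => B ω ^ 4 + C ω ^ 4) μ := hB4.add hC4
  have hR1 : Integrable (fun ω => l * A ω ^ 2 / 2) μ := (hA2.const_mul l).div_const 2
  have hR2 : Integrable (fun ω => l⁻¹ * (B ω ^ 4 + C ω ^ 4) / 4) μ := (hBC.const_mul l⁻¹).div_const 4
  have hR : Integrable (fun ω => l * A ω ^ 2 / 2 + l⁻¹ * (B ω ^ 4 + C ω ^ 4) / 4) μ := hR1.add hR2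
  refine (abs_integral_le_integral_abs).trans ((integral_mono_of_nonneg (ae_of_all _ fun ω => abs_nonneg _) hR
    (ae_of_all _ fun ω => abs_mul_mul_le_sq_quartic (A ω) (B ω) (C ω) hl)).trans (le_of_eq ?_))
  rw [integral_add hR1 hR2, integral_div, integral_const_mul, integral_div, integral_const_mul, integral_add hB4 hC4]

/-- The product of three functions, two with fourth moments and one square integrable, is integrable
(`|ABC| ≤ (A⁴+B⁴)/4 + C²/2`). -/
theorem integrable_mul_mul_of_quartic_sq {A B C : Ω → ℝ} (hA : AEStronglyMeasurable A μ) (hB : AEStronglyMeasurable B μ)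
    (hC : AEStronglyMeasurable C μ) (hA4 : Integrable (fun ω => A ω ^ 4) μ) (hB4 : Integrable (fun ω => B ω ^ 4) μ)
    (hC2 : Integrable (fun ω => C ω ^ 2) μ) : Integrable (fun ω => A ω * B ω * C ω) μ := by
  have hAB : Integrable (fun ω => A ω ^ 4 + B ω ^ 4) μ := hA4.add hB4
  have hR1 : Integrable (fun ω => 1 * (A ω ^ 4 + B ω ^ 4) / 4) μ := (hAB.const_mul 1).div_const 4
  have hR2 : Integrable (fun ω => (1:ℝ)⁻¹ * C ω ^ 2 / 2) μ := (hC2.const_mul _).div_const 2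
  have hR : Integrable (fun ω => 1 * (A ω ^ 4 + B ω ^ 4) / 4 + (1:ℝ)⁻¹ * C ω ^ 2 / 2) μ := hR1.add hR2
  exact hR.mono' ((hA.mul hB).mul hC) (ae_of_all _ fun ω => by
    rw [Real.norm_eq_abs]; exact abs_mul_mul_le_quartic_sq (A ω) (B ω) (C ω) one_pos)

end ThreeFactor

section Centred

variable {Ω : Type*} [MeasurableSpace Ω] {μ : Measure Ω} [IsProbabilityMeasure μ]

/-- `X ∈ L⁴ ⇒ X` integrable (probability space). -/
theorem integrable_of_integrable_pow_four {X : Ω → ℝ} (hX : AEStronglyMeasurable X μ) (h4 : Integrable (fun ω => X ω ^ 4) μ) :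
    Integrable X μ :=
  (memLp_two_of_integrable_pow_four hX h4).1.integrable one_le_two

/-- Jensen: `(E X)⁴ ≤ E X⁴`. -/
theorem integral_pow_four_le {X : Ω → ℝ} (hX : AEStronglyMeasurable X μ) (h4 : Integrable (fun ω => X ω ^ 4) μ) :
    (∫ ω, X ω ∂μ) ^ 4 ≤ ∫ ω, X ω ^ 4 ∂μ :=
  (Even.convexOn_pow (by decide : Even 4)).map_integral_le (continuousOn_pow 4) isClosed_univ
    (ae_of_all _ fun _ => Set.mem_univ _) (integrable_of_integrable_pow_four hX h4) h4

/-- **Centred fourth moment**: `(X − E X)⁴` is integrable and `∫ (X − E X)⁴ ≤ 16 ∫ X⁴`. -/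
theorem integral_centred_pow_four_le {X : Ω → ℝ} (hX : AEStronglyMeasurable X μ) (h4 : Integrable (fun ω => X ω ^ 4) μ) :
    Integrable (fun ω => (X ω - ∫ s, X s ∂μ) ^ 4) μ ∧ ∫ ω, (X ω - ∫ s, X s ∂μ) ^ 4 ∂μ ≤ 16 * ∫ ω, X ω ^ 4 ∂μ := by
  have hpt : ∀ ω, (X ω - ∫ s, X s ∂μ) ^ 4 ≤ 8 * (X ω ^ 4 + (∫ s, X s ∂μ) ^ 4) := fun ω =>
    Literature.Analysis.FunctionSpaces.pow_four_sub_le _ _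
  have hRint : Integrable (fun ω => 8 * (X ω ^ 4 + (∫ s, X s ∂μ) ^ 4)) μ := (h4.add (integrable_const _)).const_mul _
  have hLint : Integrable (fun ω => (X ω - ∫ s, X s ∂μ) ^ 4) μ :=
    hRint.mono' ((hX.sub aestronglyMeasurable_const).pow 4)
      (ae_of_all _ fun ω => by rw [Real.norm_eq_abs, abs_of_nonneg (by positivity)]; exact hpt ω)
  refine ⟨hLint, ?_⟩
  have hJ := integral_pow_four_le hX h4
  calc ∫ ω, (X ω - ∫ s, X s ∂μ) ^ 4 ∂μ ≤ ∫ ω, 8 * (X ω ^ 4 + (∫ s, X s ∂μ) ^ 4) ∂μ := integral_mono hLint hRint hpt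
    _ = 8 * ((∫ ω, X ω ^ 4 ∂μ) + (∫ s, X s ∂μ) ^ 4) := by
        rw [integral_const_mul, integral_add h4 (integrable_const _), integral_const, probReal_univ, one_smul]
    _ ≤ 16 * ∫ ω, X ω ^ 4 ∂μ := by linarith

/-- **Centred second moment**: `∫ (X − E X)² ≤ ∫ X²` for `X ∈ L²`. -/
theorem integral_centred_sq_le {X : Ω → ℝ} (hX : MemLp X 2 μ) :
    ∫ ω, (X ω - ∫ s, X s ∂μ) ^ 2 ∂μ ≤ ∫ ω, X ω ^ 2 ∂μ := by
  have e : ∫ ω, (X ω - μ[X]) ^ 2 ∂μ = Var[X; μ] := (variance_eq_integral hX.aestronglyMeasurable.aemeasurable).symm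
  rw [e]
  exact (variance_le_expectation_sq hX.aestronglyMeasurable).trans (le_of_eq rfl)

/-- An eighth moment shifted by a constant: `(X − a)⁸` is integrable and `∫ (X − a)⁸ ≤ 2⁷(∫X⁸ + a⁸)`. -/
theorem integral_sub_const_pow_eight_le {X : Ω → ℝ} (hX : AEStronglyMeasurable X μ) (h8 : Integrable (fun ω => X ω ^ 8) μ) (a : ℝ) :
    Integrable (fun ω => (X ω - a) ^ 8) μ ∧ ∫ ω, (X ω - a) ^ 8 ∂μ ≤ 2 ^ 7 * ((∫ ω, X ω ^ 8 ∂μ) + a ^ 8) := by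
  have hpt : ∀ ω, (X ω - a) ^ 8 ≤ 2 ^ 7 * (X ω ^ 8 + a ^ 8) := fun ω => sub_pow_eight_le _ _
  have hRint : Integrable (fun ω => 2 ^ 7 * (X ω ^ 8 + a ^ 8)) μ := (h8.add (integrable_const _)).const_mul _
  have hLint : Integrable (fun ω => (X ω - a) ^ 8) μ :=
    hRint.mono' ((hX.sub aestronglyMeasurable_const).pow 8)
      (ae_of_all _ fun ω => by rw [Real.norm_eq_abs, abs_of_nonneg (Even.pow_nonneg (by decide) _)]; exact hpt ω)
  refine ⟨hLint, (integral_mono hLint hRint hpt).trans (le_of_eq ?_)⟩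
  rw [integral_const_mul, integral_add h8 (integrable_const _), integral_const, probReal_univ, one_smul]

/-- Jensen: `(E X)² ≤ E X²` for `X ∈ L²`. -/
theorem sq_integral_le_integral_sq {X : Ω → ℝ} (hX : MemLp X 2 μ) : (∫ ω, X ω ∂μ) ^ 2 ≤ ∫ ω, X ω ^ 2 ∂μ :=
  (Even.convexOn_pow (by decide : Even 2)).map_integral_le (continuousOn_pow 2) isClosed_univ
    (ae_of_all _ fun _ => Set.mem_univ _) (hX.integrable one_le_two) hX.integrable_sq

end Centred

section Bookkeeping

/-- Pure bookkeeping of F(iii): the six error terms against the constants (`Hr = ⌈β^θ⌉ ≥ 1`, `β ≥ 1`, `Hr⁶ ≤ β²`, `Hr⁸ ≤ β⁴`,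
`L = Hr⁶/β`). -/
theorem tilt_bookkeeping {β Hr F4 A4 A8 Cc4 Cr4 CV CX Ff2 Ff4 Qf4 Qg2 Qg4 Pf4 Pg4 Uf4 Ug4 Nf4 Ng4 Ccf Ccg Crf Crg V4 R2 D2 EV2
    P8f P8g V4g T1 T2 T3 T4 T5 T6 : ℝ}
    (hβ : 1 ≤ β) (hH : 1 ≤ Hr) (h62 : Hr ^ 6 ≤ β ^ 2) (h84 : Hr ^ 8 ≤ β ^ 4)
    (hA4 : 0 ≤ A4) (hA8 : 0 ≤ A8) (hCc4 : 0 ≤ Cc4) (hCr4 : 0 ≤ Cr4)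
    (hFf2 : Ff2 ≤ (1 + Ff4) / 2) (hFf4 : Ff4 ≤ F4)
    (hQg2 : Qg2 ≤ 1 + A4) (hQf4 : Qf4 ≤ 16 * Pf4) (hPf4 : Pf4 ≤ 2 * A4) (hQg4 : Qg4 ≤ 16 * Pg4) (hPg4 : Pg4 ≤ 2 * A4)
    (hUf4 : Uf4 ≤ 16 * Nf4) (hNf4 : Nf4 ≤ 8 * (Ccf + Crf)) (hUg4 : Ug4 ≤ 16 * Ng4) (hNg4 : Ng4 ≤ 8 * (Ccg + Crg))
    (hCcf : Ccf ≤ 2 * (Cc4 * Hr ^ 6 / β ^ 2)) (hCcg : Ccg ≤ 2 * (Cc4 * Hr ^ 6 / β ^ 2))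
    (hCrf : Crf ≤ 2 * (Cr4 * Hr ^ 8 / β ^ 4)) (hCrg : Crg ≤ 2 * (Cr4 * Hr ^ 8 / β ^ 4))
    (hV4 : V4 ≤ 2 * (CV * Hr ^ 12 / β ^ 2))
    (hR2 : R2 ≤ 2 * D2 + 2 * EV2) (hD2 : D2 ≤ 2 * (CX * Hr ^ 12 / β ^ 2)) (hEV2 : EV2 ≤ 16 / β ^ 2)
    (hP8f : P8f ≤ 2 ^ 7 * (A8 + (1 + A4) ^ 4)) (hP8g : P8g ≤ 2 ^ 7 * (A8 + (1 + A4) ^ 4)) (hV4g : V4g ≤ 1)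
    (h1 : T1 ≤ Hr ^ 6 / β * Ff2 / 2 + (Hr ^ 6 / β)⁻¹ * (V4 + Ug4) / 4)
    (h2 : T2 ≤ Hr ^ 6 / β * (Ff4 + Ug4) / 4 + (Hr ^ 6 / β)⁻¹ * R2 / 2)
    (h3 : T3 ≤ Hr ^ 6 / β * Qg2 / 2 + (Hr ^ 6 / β)⁻¹ * (V4 + Uf4) / 4)
    (h4 : T4 ≤ Hr ^ 6 / β * (Qg4 + Uf4) / 4 + (Hr ^ 6 / β)⁻¹ * R2 / 2)
    (h5 : T5 ≤ Hr ^ 6 / β * (Qf4 + Qg4) / 4 + (Hr ^ 6 / β)⁻¹ * R2 / 2)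
    (h6 : T6 ≤ 2 * (1 + ((P8f + P8g) / 4 + V4g / 2)) * (1 / β)) :
    T1 + T2 + T3 + T4 + T5 + T6 ≤
      ((1 + F4) / 4 + (1 + A4) / 2 + 2 * (CV / 2 + 64 * (Cc4 + Cr4)) + (F4 + 256 * (Cc4 + Cr4)) / 4 +
        (32 * A4 + 256 * (Cc4 + Cr4)) / 4 + 16 * A4 + 3 * (2 * CX + 16) + (3 + 2 ^ 7 * (A8 + (1 + A4) ^ 4))) * (Hr ^ 6 / β) := by
  have hβ0 : 0 < β := by linarith
  have hH0 : 0 < Hr := by linarith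
  have hL0 : 0 < Hr ^ 6 / β := by positivity
  have hH6 : 1 ≤ Hr ^ 6 := one_le_pow₀ hH
  -- units: `1/β ≤ L`, `1/β ≤ 1`
  have hu1 : 1 / β ≤ 1 := by rw [div_le_one hβ0]; exact hβ
  have huL : 1 / β ≤ Hr ^ 6 / β := div_le_div_of_nonneg_right hH6 hβ0.le
  -- `Cc4·Hr⁶/β² ≤ Cc4`, `Cr4·Hr⁸/β⁴ ≤ Cr4`
  have hc1 : Cc4 * Hr ^ 6 / β ^ 2 ≤ Cc4 := by
    rw [mul_div_assoc]; exact mul_le_of_le_one_right hCc4 ((div_le_one (by positivity)).2 h62)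
  have hr1 : Cr4 * Hr ^ 8 / β ^ 4 ≤ Cr4 := by
    rw [mul_div_assoc]; exact mul_le_of_le_one_right hCr4 ((div_le_one (by positivity)).2 h84)
  have hUf : Uf4 ≤ 256 * (Cc4 + Cr4) := by linarith only [hUf4, hNf4, hCcf, hCrf, hc1, hr1]
  have hUg : Ug4 ≤ 256 * (Cc4 + Cr4) := by linarith only [hUg4, hNg4, hCcg, hCrg, hc1, hr1]
  -- `L⁻¹ · (moments)`:
  have eV : (Hr ^ 6 / β)⁻¹ * (2 * (CV * Hr ^ 12 / β ^ 2)) = 2 * CV * (Hr ^ 6 / β) := by field_simp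
  have hLV : (Hr ^ 6 / β)⁻¹ * V4 ≤ 2 * CV * (Hr ^ 6 / β) := by
    rw [← eV]; exact mul_le_mul_of_nonneg_left hV4 (inv_nonneg.2 hL0.le)
  have eC : (Hr ^ 6 / β)⁻¹ * (2 * (Cc4 * Hr ^ 6 / β ^ 2)) = 2 * Cc4 * (1 / β) := by field_simp
  have eR : (Hr ^ 6 / β)⁻¹ * (2 * (Cr4 * Hr ^ 8 / β ^ 4)) = 2 * Cr4 * (Hr ^ 2 / β ^ 3) := by field_simp
  have h23 : Hr ^ 2 / β ^ 3 ≤ Hr ^ 6 / β := by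
    rw [div_le_div_iff₀ (by positivity) hβ0]
    have h1 : Hr ^ 2 ≤ Hr ^ 6 := pow_le_pow_right₀ hH (by norm_num)
    have h2 : β ≤ β ^ 3 := le_self_pow₀ hβ (by norm_num)
    calc Hr ^ 2 * β ≤ Hr ^ 6 * β := mul_le_mul_of_nonneg_right h1 hβ0.le
      _ ≤ Hr ^ 6 * β ^ 3 := mul_le_mul_of_nonneg_left h2 (by positivity)
  have hc' : (Hr ^ 6 / β)⁻¹ * (2 * (Cc4 * Hr ^ 6 / β ^ 2)) ≤ 2 * Cc4 * (Hr ^ 6 / β) := by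
    rw [eC]; exact mul_le_mul_of_nonneg_left huL (by positivity)
  have hr' : (Hr ^ 6 / β)⁻¹ * (2 * (Cr4 * Hr ^ 8 / β ^ 4)) ≤ 2 * Cr4 * (Hr ^ 6 / β) := by
    rw [eR]; exact mul_le_mul_of_nonneg_left h23 (by positivity)
  have e128 : (Hr ^ 6 / β)⁻¹ * (128 * (2 * (Cc4 * Hr ^ 6 / β ^ 2)) + 128 * (2 * (Cr4 * Hr ^ 8 / β ^ 4))) =
      128 * ((Hr ^ 6 / β)⁻¹ * (2 * (Cc4 * Hr ^ 6 / β ^ 2))) + 128 * ((Hr ^ 6 / β)⁻¹ * (2 * (Cr4 * Hr ^ 8 / β ^ 4))) := by ring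
  have hLUf : (Hr ^ 6 / β)⁻¹ * Uf4 ≤ 256 * (Cc4 + Cr4) * (Hr ^ 6 / β) := by
    have hN : Uf4 ≤ 128 * (2 * (Cc4 * Hr ^ 6 / β ^ 2)) + 128 * (2 * (Cr4 * Hr ^ 8 / β ^ 4)) := by
      linarith only [hUf4, hNf4, hCcf, hCrf]
    have h := mul_le_mul_of_nonneg_left hN (inv_nonneg.2 hL0.le)
    rw [e128] at h
    linarith only [h, hc', hr']
  have hLUg : (Hr ^ 6 / β)⁻¹ * Ug4 ≤ 256 * (Cc4 + Cr4) * (Hr ^ 6 / β) := by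
    have hN : Ug4 ≤ 128 * (2 * (Cc4 * Hr ^ 6 / β ^ 2)) + 128 * (2 * (Cr4 * Hr ^ 8 / β ^ 4)) := by
      linarith only [hUg4, hNg4, hCcg, hCrg]
    have h := mul_le_mul_of_nonneg_left hN (inv_nonneg.2 hL0.le)
    rw [e128] at h
    linarith only [h, hc', hr']
  -- `L⁻¹ R2 ≤ (4 CX + 32) L`
  have eX : (Hr ^ 6 / β)⁻¹ * (2 * (CX * Hr ^ 12 / β ^ 2)) = 2 * CX * (Hr ^ 6 / β) := by field_simp
  have eE : (Hr ^ 6 / β)⁻¹ * (16 / β ^ 2) = 16 * (1 / (Hr ^ 6 * β)) := by field_simp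
  have hE' : 1 / (Hr ^ 6 * β) ≤ Hr ^ 6 / β := by
    rw [div_le_div_iff₀ (by positivity) hβ0]
    have h1 : β ≤ Hr ^ 6 * β := le_mul_of_one_le_left hβ0.le hH6
    have h2 : Hr ^ 6 * β ≤ Hr ^ 6 * (Hr ^ 6 * β) := mul_le_mul_of_nonneg_left h1 (by positivity)
    linarith only [h1, h2]
  have hLR : (Hr ^ 6 / β)⁻¹ * R2 ≤ (4 * CX + 32) * (Hr ^ 6 / β) := by
    have hN : R2 ≤ 2 * (2 * (CX * Hr ^ 12 / β ^ 2)) + 2 * (16 / β ^ 2) := by linarith only [hR2, hD2, hEV2]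
    have h := mul_le_mul_of_nonneg_left hN (inv_nonneg.2 hL0.le)
    have e2 : (Hr ^ 6 / β)⁻¹ * (2 * (2 * (CX * Hr ^ 12 / β ^ 2)) + 2 * (16 / β ^ 2)) =
        2 * ((Hr ^ 6 / β)⁻¹ * (2 * (CX * Hr ^ 12 / β ^ 2))) + 2 * ((Hr ^ 6 / β)⁻¹ * (16 / β ^ 2)) := by ring
    rw [e2, eX, eE] at h
    have hE'' : 16 * (1 / (Hr ^ 6 * β)) ≤ 16 * (Hr ^ 6 / β) := mul_le_mul_of_nonneg_left hE' (by norm_num)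
    linarith only [h, hE'']
  -- `L · (O(1) moments)`
  have hL := hL0.le
  have hT1 : T1 ≤ ((1 + F4) / 4 + (CV / 2 + 64 * (Cc4 + Cr4))) * (Hr ^ 6 / β) := by
    have ha : Hr ^ 6 / β * Ff2 ≤ Hr ^ 6 / β * ((1 + F4) / 2) := mul_le_mul_of_nonneg_left (by linarith only [hFf2, hFf4]) hL
    have hb : (Hr ^ 6 / β)⁻¹ * (V4 + Ug4) = (Hr ^ 6 / β)⁻¹ * V4 + (Hr ^ 6 / β)⁻¹ * Ug4 := mul_add _ _ _
    rw [hb] at h1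
    linarith only [h1, ha, hLV, hLUg]
  have hT2 : T2 ≤ ((F4 + 256 * (Cc4 + Cr4)) / 4 + (2 * CX + 16)) * (Hr ^ 6 / β) := by
    have ha : Hr ^ 6 / β * (Ff4 + Ug4) ≤ Hr ^ 6 / β * (F4 + 256 * (Cc4 + Cr4)) :=
      mul_le_mul_of_nonneg_left (by linarith only [hFf4, hUg]) hL
    linarith only [h2, ha, hLR]
  have hT3 : T3 ≤ ((1 + A4) / 2 + (CV / 2 + 64 * (Cc4 + Cr4))) * (Hr ^ 6 / β) := by
    have ha : Hr ^ 6 / β * Qg2 ≤ Hr ^ 6 / β * (1 + A4) := mul_le_mul_of_nonneg_left hQg2 hL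
    have hb : (Hr ^ 6 / β)⁻¹ * (V4 + Uf4) = (Hr ^ 6 / β)⁻¹ * V4 + (Hr ^ 6 / β)⁻¹ * Uf4 := mul_add _ _ _
    rw [hb] at h3
    linarith only [h3, ha, hLV, hLUf]
  have hT4 : T4 ≤ ((32 * A4 + 256 * (Cc4 + Cr4)) / 4 + (2 * CX + 16)) * (Hr ^ 6 / β) := by
    have ha : Hr ^ 6 / β * (Qg4 + Uf4) ≤ Hr ^ 6 / β * (32 * A4 + 256 * (Cc4 + Cr4)) :=
      mul_le_mul_of_nonneg_left (by linarith only [hQg4, hPg4, hUf]) hL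
    linarith only [h4, ha, hLR]
  have hT5 : T5 ≤ (16 * A4 + (2 * CX + 16)) * (Hr ^ 6 / β) := by
    have ha : Hr ^ 6 / β * (Qf4 + Qg4) ≤ Hr ^ 6 / β * (64 * A4) :=
      mul_le_mul_of_nonneg_left (by linarith only [hQf4, hPf4, hQg4, hPg4]) hL
    linarith only [h5, ha, hLR]
  have hT6 : T6 ≤ (3 + 2 ^ 7 * (A8 + (1 + A4) ^ 4)) * (Hr ^ 6 / β) := by
    have hS : 2 * (1 + ((P8f + P8g) / 4 + V4g / 2)) ≤ 3 + 2 ^ 7 * (A8 + (1 + A4) ^ 4) := by linarith only [hP8f, hP8g, hV4g]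
    have hS0 : 0 ≤ 3 + 2 ^ 7 * (A8 + (1 + A4) ^ 4) := by positivity
    exact h6.trans ((mul_le_mul_of_nonneg_right hS (by positivity)).trans (mul_le_mul_of_nonneg_left huL hS0))
  linarith only [hT1, hT2, hT3, hT4, hT5, hT6]

end Bookkeeping


end Summit.QuantumFields.YangMills.Theorems.AllWindowsColdBoxBoxMidLine

namespace Summit.QuantumFields.YangMills.Theorems.AllWindowsColdBoxBoxMidLine

section SmallTools

/-- `|a₁ + ⋯ + a₆| ≤ |a₁| + ⋯ + |a₆|`. -/
theorem abs_add_six_le (a b c d e f : ℝ) : |a + b + c + d + e + f| ≤ |a| + |b| + |c| + |d| + |e| + |f| := by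
  have h1 := abs_add_le a b
  have h2 := abs_add_le (a + b) c
  have h3 := abs_add_le (a + b + c) d
  have h4 := abs_add_le (a + b + c + d) e
  have h5 := abs_add_le (a + b + c + d + e) f
  linarith

/-- Eventually in `β` (`0 < θ ≤ 1/16`): `⌈β^θ⌉⁶ ≤ β²` and `⌈β^θ⌉⁸ ≤ β⁴`. -/
theorem eventually_ceil_pow_le {θ : ℝ} (hθ : 0 < θ) (hθ16 : θ ≤ 1 / 16) :
    ∃ β₀ : ℝ, ∀ β : ℝ, β₀ ≤ β → (⌈β ^ θ⌉₊ : ℝ) ^ 6 ≤ β ^ 2 ∧ (⌈β ^ θ⌉₊ : ℝ) ^ 8 ≤ β ^ 4 := by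
  obtain ⟨b₁, hb₁, m₁⟩ := eventually_monomial_le_one 1 6 hθ (a := -2) (by push_cast; linarith)
  obtain ⟨b₂, -, m₂⟩ := eventually_monomial_le_one 1 8 hθ (a := -4) (by push_cast; linarith)
  refine ⟨max b₁ b₂, fun β hβ => ?_⟩
  have hβ1 : 1 ≤ β := hb₁.trans ((le_max_left _ _).trans hβ)
  have hβ0 : 0 < β := by linarith
  have hH0 : (0 : ℝ) ≤ (⌈β ^ θ⌉₊ : ℝ) := Nat.cast_nonneg _
  have hle : (⌈β ^ θ⌉₊ : ℝ) ≤ 2 * (⌈β ^ θ⌉₊ : ℝ) + 3 := by linarith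
  have k₁ := m₁ β ((le_max_left _ _).trans hβ)
  have k₂ := m₂ β ((le_max_right _ _).trans hβ)
  have hi2 : β ^ (-2 : ℝ) = (β ^ 2)⁻¹ := by rw [Real.rpow_neg hβ0.le, Real.rpow_two]
  have hi4 : β ^ (-4 : ℝ) = (β ^ 4)⁻¹ := by
    rw [Real.rpow_neg hβ0.le, show (4 : ℝ) = ((4 : ℕ) : ℝ) by norm_num, Real.rpow_natCast]
  rw [one_mul, hi2, ← div_eq_mul_inv, div_le_one (by positivity)] at k₁
  rw [one_mul, hi4, ← div_eq_mul_inv, div_le_one (by positivity)] at k₂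
  exact ⟨(pow_le_pow_left₀ hH0 hle 6).trans k₁, (pow_le_pow_left₀ hH0 hle 8).trans k₂⟩


end SmallTools

end Summit.QuantumFields.YangMills.Theorems.AllWindowsColdBoxBoxMidLine

end
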